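/-
Copyright (c) 2026 the pub-hodgecm-mathlib formalisation cell (harness21).  Prover seat hodgecm-mathlib-K2Liu-p14 (g0): Track B «K2-LIT»,
hLiu418 = stmt-HodgeConjecture-24832; RULINGS M-156m ∕ M-156o «A7 = GK COCYCLE ROAD» (B4's `|f|`-chain), co-dealer K2E5-plan (g6).
-/
import Summits.HodgeConjecture.HodgeConjecture.Theorems.K2LiuFlatSiegelFamilies     -- ★ B2 (flat families); brings ★ #7c `isUnit_detDelta`, ★ K2Lit D1, ★ (a)
import HarnessLib

/-!
# Crux `HLiu418`, road `K2_Liu`, organ A7-reg (GK cocycle road), file B2′: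
# NORMS OF SIEGEL SECTIONS — `‖f‖` is a Siegel section for the TRIVIAL characters at `re s`; the `SL₂` relation passes to `‖f‖`

Cell `hodgecm-mathlib`, crux item hLiu418 = `stmt-HodgeConjecture-24832`; squad K2 ∕ K2Liu; prover K2Liu-p14 (g0).
THEOREMS ONLY (no `def`, no instance, no notation, no named-fact hypothesis, no `sorry`); lane `--supports stmt-HodgeConjecture-24832`
(count-neutral helper).  FRAME-FREE, RANK-GENERIC (`E/F`, `c`, `δ`, any finite `v`, any `n`, `H_v = ★ UnitaryGroup.localPi E c (n+n) J^𝔻 v`).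

THE ROLE OF THIS FILE.  The Tonelli step of the cocycle `M_w(s) = A₂ ∘ A₁ ∘ A₂` (★ B4-abs `K2LiuIteratedRankOneCocycle.integrable_of_iterated`,
K2Liu-p09 (g5)) needs the three iterated integrals of `|f_s|` to be finite; the device is that **`|f_s|` is again a section** — for the trivial
local characters at the REAL parameter `re s` — so each majorant integral is an instance of the abstract rank-one VALUE theorem
(★ `K2LiuRankOneOperators.integrable_and_integral_eq`) on a non-negative section.  This file supplies that device BY NAME:
* §1 (abstract, ★ `K2LiuRankOneOperators`' currency, any group `G`): the `SL₂` relation `f(w u(x) g) = C₀ ν(x)⁻¹ ‖x‖^{−e} f(ū(x⁻¹) g)` for `f`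
  implies the same relation for `g ↦ ‖f g‖` with the datum `(ν := 1, e := re e, C₀ := ‖C₀‖)`; right-`K′`-invariance passes to `‖f‖`.
* §2 (the Siegel parabolic): for UNITARY `χ_v`, `‖χ_v(det_Δ p)‖ = 1` and **`‖localSiegelCharacter χ_v s p‖ = localSiegelCharacter 1 (re s) p`**
  on `P_Δ(F_v)` (`|det_Δ p|_v > 0` as every `det_Δ p_w` is a unit, ★ `isUnit_detDelta`); the character of the trivial family `1` is POSITIVE REAL.
* §3 (sections): **`IsLocalSiegelSection χ_v s f → IsLocalSiegelSection 1 (re s) (‖f‖)`**, `IsSmooth f → IsSmooth ‖f‖`, and flatness on `K₀`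
  ∕ right-`K′`-invariance pass to `‖f‖` — so a flat family of smooth Siegel sections has a flat family of smooth MAJORANT sections
  `s ↦ ‖f_s‖ ∈ I_v(re s, 1)`, to which ★ B2 (`exists_uniform_level`) and ★ `K2LiuRankOneOperators` apply verbatim.
HONEST LABEL.  `HC_CM` is proved only modulo the 7 printed citations (2 remaining named inputs: hLiu418 = `stmt-HodgeConjecture-24832`,
h413 = `stmt-HodgeConjecture-24833`) until rung 0 closes.

## References
* [KudlaSweet1997] S. Kudla, W. J. Sweet, Israel J. Math. 98 (1997), §1 (convergence of `M(s)` on standard sections via the spherical majorant).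
* [HarrisKudlaSweet1996] M. Harris, S. Kudla, W. J. Sweet, J. Amer. Math. Soc. 9 (1996), §1 (1.15) (`|χ(x(p))||x(p)|^{re s + ρ}`).
* [Casselman1980] W. Casselman, Compositio Math. 40 (1980), §3 (absolute convergence of `T_w` by comparison with the unramified section).
-/

set_option autoImplicit false
set_option linter.dupNamespace false -- the mandated namespace repeats `HodgeConjecture.HodgeConjecture`

noncomputable section

open NumberField IsDedekindDomain
open scoped NNReal
open Literature.NumberTheory.GaloisRepresentations Literature.NumberTheory.GaloisRepresentations.IsNonarchimedeanLocalField
open Literature.NumberTheory.Automorphic Literature.NumberTheory.Automorphic.UnitaryGroup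
open Literature.NumberTheory.GelbartRogawski1991.UnitaryDualPair.LocalSplitting
open Literature.NumberTheory.K2Lit.LocalSiegelDoubled
open Summit.HodgeConjecture.HodgeConjecture.Cruxes.HLiu418.K2LiuLocalSiegel (isUnit_detDelta)
open Summit.HodgeConjecture.HodgeConjecture.Cruxes.HLiu418.K2LiuFlatSiegelFamilies

namespace Summit.HodgeConjecture.HodgeConjecture.Cruxes.HLiu418.K2LiuSiegelSectionNorm

/-! ## §1 Abstract: the `SL₂` relation and the right-invariance pass to `‖f‖` -/

section Abstract

variable {K : Type} [Field K] [NumberField K] {w : HeightOneSpectrum (𝓞 K)} {G : Type*} [Group G]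

/-- `‖(r : ℂ) ^ (−e)‖ = ((r : ℂ) ^ (−(re e : ℂ)))` as a complex number, for `r > 0`. [folklore] -/
theorem ofReal_norm_ofReal_cpow_neg {r : ℝ} (hr : 0 < r) (e : ℂ) :
    ((‖(r : ℂ) ^ (-e)‖ : ℝ) : ℂ) = (r : ℂ) ^ (-(e.re : ℂ)) := by
  rw [Complex.norm_cpow_eq_rpow_re_of_pos hr, Complex.ofReal_cpow hr.le, Complex.neg_re, Complex.ofReal_neg]

/-- **The `SL₂` relation passes to `‖f‖`** with the datum `(ν := 1, e := re e, C₀ := ‖C₀‖)`: if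
`f(w u(x) g) = C₀ ν(x)⁻¹ ‖x‖^{−e} f(ū(x⁻¹) g)` for a unitary `ν`, then `‖f‖(w u(x) g) = ‖C₀‖ · 1 · ‖x‖^{−re e} · ‖f‖(ū(x⁻¹) g)` — the `hrel` binder of
★ `K2LiuRankOneOperators.integrable_and_integral_eq` for the majorant. [cite: Casselman1980, §3] [cite: KudlaSweet1997, §1] -/
theorem hrel_norm {f : G → ℂ} {u ū : w.adicCompletion K → G} {w₀ : G} {ν : (w.adicCompletion K)ˣ →* ℂˣ}
    (hν : ∀ x, ‖((ν x : ℂˣ) : ℂ)‖ = 1) {e C₀ : ℂ}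
    (hrel : ∀ (x : (w.adicCompletion K)ˣ) (g : G),
      f (w₀ * u x * g) = C₀ * (((ν x)⁻¹ : ℂˣ) : ℂ) * ((normAbs (w.adicCompletion K) (x : w.adicCompletion K) : ℝ) : ℂ) ^ (-e) *
        f (ū ((x⁻¹ : (w.adicCompletion K)ˣ) : w.adicCompletion K) * g))
    (x : (w.adicCompletion K)ˣ) (g : G) :
    ((‖f (w₀ * u x * g)‖ : ℝ) : ℂ) = (‖C₀‖ : ℂ) * ((((1 : (w.adicCompletion K)ˣ →* ℂˣ) x)⁻¹ : ℂˣ) : ℂ) *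
      ((normAbs (w.adicCompletion K) (x : w.adicCompletion K) : ℝ) : ℂ) ^ (-((e.re : ℝ) : ℂ)) *
        ((‖f (ū ((x⁻¹ : (w.adicCompletion K)ˣ) : w.adicCompletion K) * g)‖ : ℝ) : ℂ) := by
  have hx0 : (0 : ℝ) < (normAbs (w.adicCompletion K) (x : w.adicCompletion K) : ℝ) :=
    NNReal.coe_pos.2 (pos_iff_ne_zero.2 ((map_ne_zero (normAbs (w.adicCompletion K))).2 x.ne_zero))
  have hνinv : ‖(((ν x)⁻¹ : ℂˣ) : ℂ)‖ = 1 := by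
    rw [Units.val_inv_eq_inv_val, norm_inv, hν, inv_one]
  rw [hrel x g, norm_mul, norm_mul, norm_mul, hνinv, mul_one, MonoidHom.one_apply, inv_one, Units.val_one, mul_one]
  push_cast
  rw [ofReal_norm_ofReal_cpow_neg hx0]

/-- right-`K′`-invariance passes to `‖f‖`. [folklore] -/
theorem norm_invariant {f : G → ℂ} {K' : Subgroup G} (hfK : ∀ g, ∀ k ∈ K', f (g * k) = f g) (g : G) {k : G} (hk : k ∈ K') :
    ((‖f (g * k)‖ : ℝ) : ℂ) = ((‖f g‖ : ℝ) : ℂ) := by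
  rw [hfK g k hk]

end Abstract

/-! ## §2 The Siegel parabolic: `‖χ_v(det_Δ p)‖ = 1`, `‖localSiegelCharacter χ_v s p‖ = localSiegelCharacter 1 (re s) p` -/

section Place

variable (F : Type) [Field F] [NumberField F] (E : Type) [Field E] [NumberField E] [Algebra F E]
  [Algebra.IsQuadraticExtension F E] (c : E ≃ₐ[F] E)
  {δ : E} (hcδ : c δ = -δ) (hδ : δ ≠ 0) {d : F} (hd : δ * δ = algebraMap F E d)
  (v : HeightOneSpectrum (𝓞 F)) (n : ℕ) {T₀ : Matrix (Fin n) (Fin n) F} (hT₀ : T₀.IsSymm)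
  {JD : Matrix (Fin (n + n)) (Fin (n + n)) E} (hJD : JD = (gramD F n T₀).map (algebraMap F E))

omit [Algebra.IsQuadraticExtension F E] in
/-- **`‖χ_v(det_Δ h)‖ = 1`** for unitary local characters (every factor of ★ `chiDet` is a character value or `1`).
[cite: HarrisKudlaSweet1996, §1 (1.15)] -/
theorem norm_chiDet_eq_one {χv : ∀ w : PlacesOver E v, (w.1.adicCompletion E)ˣ →* ℂˣ}
    (hχ : ∀ (w : PlacesOver E v) (x : (w.1.adicCompletion E)ˣ), ‖((χv w x : ℂˣ) : ℂ)‖ = 1)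
    (h : UnitaryGroup.localPi E c (n + n) JD v) : ‖((chiDet F E c v n χv h : ℂˣ) : ℂ)‖ = 1 := by
  classical
  unfold chiDet
  rw [Units.coe_prod, norm_prod]
  refine Finset.prod_eq_one fun w _ => ?_
  split_ifs with hu
  · exact hχ w _
  · rw [Units.val_one, norm_one]

omit [Algebra.IsQuadraticExtension F E] in
/-- `χ_v(det_Δ h) = 1` for the trivial family. [cite: HarrisKudlaSweet1996, §1 (1.15)] -/
theorem chiDet_one (h : UnitaryGroup.localPi E c (n + n) JD v) :
    chiDet F E c v n (fun w : PlacesOver E v => (1 : (w.1.adicCompletion E)ˣ →* ℂˣ)) h = 1 := by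
  classical
  unfold chiDet
  exact Finset.prod_eq_one fun w _ => by split_ifs <;> rfl

omit [Algebra.IsQuadraticExtension F E] in
/-- **the character of the trivial family at a REAL parameter is real**: `localSiegelCharacter 1 σ h = |det_Δ h|_v^{σ + n/2}` (a real power, cast
to `ℂ`; positive on `P_Δ(F_v)` by ★ `K2LiuLocalIntertwiningProperty.absDetDelta_pos`). [cite: HarrisKudlaSweet1996, §1 (1.15)] -/
theorem localSiegelCharacter_one_ofReal (p : UnitaryGroup.localPi E c (n + n) JD v) (σ : ℝ) :
    localSiegelCharacter F E c v n (fun w : PlacesOver E v => (1 : (w.1.adicCompletion E)ˣ →* ℂˣ)) (σ : ℂ) p =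
      ((absDetDelta F E c v n p ^ (σ + (n : ℝ) / 2) : ℝ) : ℂ) := by
  rw [localSiegelCharacter, chiDet_one, Units.val_one, one_mul, Complex.ofReal_cpow (absDetDelta_nonneg F E c v n p)]
  push_cast
  ring_nf

/-- **`‖localSiegelCharacter χ_v s p‖ = localSiegelCharacter 1 (re s) p`** on `P_Δ(F_v)` for UNITARY `χ_v` (`‖χ_v(det_Δ p)‖ = 1`,
`‖x^{s + n/2}‖ = x^{re s + n/2}` for `x = |det_Δ p|_v > 0`). [cite: HarrisKudlaSweet1996, §1 (1.15)] [cite: KudlaSweet1997, §1] -/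
theorem ofReal_norm_localSiegelCharacter {χv : ∀ w : PlacesOver E v, (w.1.adicCompletion E)ˣ →* ℂˣ}
    (hχ : ∀ (w : PlacesOver E v) (x : (w.1.adicCompletion E)ˣ), ‖((χv w x : ℂˣ) : ℂ)‖ = 1)
    {p : UnitaryGroup.localPi E c (n + n) JD v} (hp : IsSiegelDelta F E c hcδ hδ hd v n hT₀ hJD p) (s : ℂ) :
    ((‖localSiegelCharacter F E c v n χv s p‖ : ℝ) : ℂ) =
      localSiegelCharacter F E c v n (fun w : PlacesOver E v => (1 : (w.1.adicCompletion E)ˣ →* ℂˣ)) (s.re : ℂ) p := by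
  -- `|det_Δ p|_v > 0` on `P_Δ` (★ `K2LiuLocalIntertwiningProperty.absDetDelta_pos`, re-derived inline from ★ `isUnit_detDelta` to keep the imports light)
  have hpos : 0 < absDetDelta F E c v n p :=
    Finset.prod_pos fun w _ => norm_pos_iff.2 (isUnit_detDelta F E c hcδ hδ hd v n hT₀ hJD p hp w).ne_zero
  rw [localSiegelCharacter_one_ofReal F E c v n p, localSiegelCharacter, norm_mul, norm_chiDet_eq_one F E c v n hχ, one_mul,
    Complex.norm_cpow_eq_rpow_re_of_pos hpos]
  congr 2
  simp

end Place

/-! ## §3 Sections: `‖f‖ ∈ I_v(re s, 1)`; smoothness, flatness, right-invariance pass to `‖f‖` -/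

section Sections

variable (F : Type) [Field F] [NumberField F] (E : Type) [Field E] [NumberField E] [Algebra F E]
  [Algebra.IsQuadraticExtension F E] (c : E ≃ₐ[F] E)
  {δ : E} (hcδ : c δ = -δ) (hδ : δ ≠ 0) {d : F} (hd : δ * δ = algebraMap F E d)
  (v : HeightOneSpectrum (𝓞 F)) (n : ℕ) {T₀ : Matrix (Fin n) (Fin n) F} (hT₀ : T₀.IsSymm)
  {JD : Matrix (Fin (n + n)) (Fin (n + n)) E} (hJD : JD = (gramD F n T₀).map (algebraMap F E))

/-- **`‖f‖` is a Siegel section for the trivial characters at `re s`** when `f ∈ I_v(s, χ_v)` with `χ_v` unitary: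
`‖f (p h)‖ = |det_Δ p|_v^{re s + n/2} ‖f h‖`. [cite: KudlaSweet1997, §1] [cite: HarrisKudlaSweet1996, §1 (1.15)] -/
theorem isLocalSiegelSection_norm {χv : ∀ w : PlacesOver E v, (w.1.adicCompletion E)ˣ →* ℂˣ}
    (hχ : ∀ (w : PlacesOver E v) (x : (w.1.adicCompletion E)ˣ), ‖((χv w x : ℂˣ) : ℂ)‖ = 1) {s : ℂ}
    {f : UnitaryGroup.localPi E c (n + n) JD v → ℂ} (hf : IsLocalSiegelSection F E c hcδ hδ hd v n hT₀ hJD χv s f) :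
    IsLocalSiegelSection F E c hcδ hδ hd v n hT₀ hJD (fun w : PlacesOver E v => (1 : (w.1.adicCompletion E)ˣ →* ℂˣ)) (s.re : ℂ)
      fun h => ((‖f h‖ : ℝ) : ℂ) := by
  intro p hp h
  show ((‖f (p * h)‖ : ℝ) : ℂ) = _
  rw [hf p hp h, norm_mul, Complex.ofReal_mul, ofReal_norm_localSiegelCharacter F E c hcδ hδ hd v n hT₀ hJD hχ hp]

omit [Algebra.IsQuadraticExtension F E] in
/-- smoothness passes to `‖f‖`. [folklore] -/
theorem isSmooth_norm {f : UnitaryGroup.localPi E c (n + n) JD v → ℂ} (hf : IsSmooth F E c v n f) :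
    IsSmooth F E c v n (JD := JD) fun h => ((‖f h‖ : ℝ) : ℂ) := by
  obtain ⟨U, hU⟩ := hf
  exact ⟨U, fun h u hu => by simp only [hU h u hu]⟩

omit [Algebra.IsQuadraticExtension F E] in
/-- flatness on `K₀` passes to the norm family. [cite: KudlaSweet1997, §1] -/
theorem norm_flat {f : ℂ → UnitaryGroup.localPi E c (n + n) JD v → ℂ} {K₀ : Subgroup (UnitaryGroup.localPi E c (n + n) JD v)}
    (hflat : ∀ s s' : ℂ, ∀ k ∈ K₀, f s k = f s' k) (s s' : ℂ) {k : UnitaryGroup.localPi E c (n + n) JD v} (hk : k ∈ K₀) :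
    ((‖f s k‖ : ℝ) : ℂ) = ((‖f s' k‖ : ℝ) : ℂ) := by
  rw [hflat s s' k hk]

omit [Algebra.IsQuadraticExtension F E] in
/-- right-`K′`-invariance passes to `‖f‖` (the `hfK` binder of ★ `K2LiuRankOneOperators` for the majorant). [folklore] -/
theorem norm_rightInvariant {f : UnitaryGroup.localPi E c (n + n) JD v → ℂ} {K' : Subgroup (UnitaryGroup.localPi E c (n + n) JD v)}
    (hfK : ∀ g, ∀ k ∈ K', f (g * k) = f g) (g : UnitaryGroup.localPi E c (n + n) JD v)
    {k : UnitaryGroup.localPi E c (n + n) JD v} (hk : k ∈ K') : ((‖f (g * k)‖ : ℝ) : ℂ) = ((‖f g‖ : ℝ) : ℂ) := by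
  rw [hfK g k hk]

omit [Algebra.IsQuadraticExtension F E] in
/-- **the majorant section is non-negative real**: `0 ≤ ‖f h‖` with `((‖f h‖ : ℝ) : ℂ)` of zero imaginary part — recorded in the form Tonelli
consumes (`Complex.ofReal_re`∕`_im`). [folklore] -/
theorem norm_section_nonneg (f : UnitaryGroup.localPi E c (n + n) JD v → ℂ) (h : UnitaryGroup.localPi E c (n + n) JD v) :
    0 ≤ (((‖f h‖ : ℝ) : ℂ)).re ∧ (((‖f h‖ : ℝ) : ℂ)).im = 0 :=
  ⟨by rw [Complex.ofReal_re]; exact norm_nonneg _, Complex.ofReal_im _⟩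

end Sections

end Summit.HodgeConjecture.HodgeConjecture.Cruxes.HLiu418.K2LiuSiegelSectionNorm

end
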